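import Summits.AtomisticToContinuum.Crystallization.Theorems.FrustratedLawDichotomyStrainedPatchHomSplitNarrowQuot

/-!
# `(H_W) HomFloorW ρ_U ρ_ξ m` — the NARROW integer ROOT BOXES (parametric in integer half-widths) and their containment lemmas

decomp-a2c hand-1 g45 (crux `AperiodicFrustratedLawGap`, stmt-AtomisticToContinuum-27623; `(H) HomFloor`; sequel of `…StrainedPatchHomSplitNarrowQuot`, closing
the narrow root chain).  The record root boxes are `rootC / rootW` (fcc: centre `SC·δ`, half-width `SC/4` on the nine entries) and the quarter box
`rootCHQ / rootWHQ` (hcp: the same entries plus the two WALL entries `u₀₁ ∈ [0, 1/4]`, `u₁₂ ∈ [−1/4, 0]` and the shuffle cube `[−1/4, 1/4]³`).  For a family of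
radii `(ρ_U, ρ_ξ)` the certificate wants the SAME shapes with smaller integer half-widths.  This file defines them PARAMETRICALLY — `rootWr h` (fcc, half-width `h`
on every entry), `rootCHQr k / rootWHQr h k wξ` (hcp quarter box: wall entries centred at `±k` with half-width `k`, other entries half-width `h`, shuffles
half-width `wξ`) — so that no radius is frozen into the tree, and proves the containments under the integer side conditions `ρ_U·SC ≤ h`, `ρ_U·SC ≤ 2k`,
`ρ_ξ·SC ≤ wξ`:

* §1 `rootWr`, ★ `mem_rootWr_of_near`; ★★ `fccHalfW_of_entryTree` (the fcc hypothesis of `homFloorW_of_prunedBoxSums_selfAdjoint` at radius `ρ_U ≤ 1/4` from ONE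
  `treeOK verdict t rootC (rootWr h) = true`, any verdict sound in the record `hver` shape — the record `…EntryGram.fccHalf_of_entryTree` with the box narrowed);
* §2 `rootCHQr`, `rootWHQr`, their values, ★ `mem_rootQr` (every narrow admissible `(U, ξ)` of the fundamental domain lies in the box);
* §3 ★★ `hcpDichW_of_semOKHQ_rootQr` and ★★★ `homFloorW_of_entryTree_semOKHQ_rootQr` — `(H_W) HomFloorW ρ_U ρ_ξ m` from ONE fcc tree fact on `(rootC, rootWr h)`
  and ONE `semOKHQ μ (rootCHQr k) (rootWHQr h k wξ)` fact; the (I3) literals `h = 2⁴⁵` (`1/8`), `k = 2⁴⁴`, `wξ = 2⁴⁴` (`1/16`) as a corollary.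

Definitions are integer box data only (computable); 0 sorry; standard axioms; no instances / notation / `#eval`.  `--supports stmt-AtomisticToContinuum-27623`.
-/

noncomputable section

namespace Summit.AtomisticToContinuum.Crystallization.Theorems.FrustratedLawDichotomyStrainedPatchHomSplitNarrow

open scoped BigOperators Classical RealInnerProductSpace
open Literature.Analysis.ValidatedNumerics.Numerics
open Summit.AtomisticToContinuum.Crystallization.Theorems.ChargedEnergyGapNegative (E3)
open Summit.AtomisticToContinuum.Crystallization.Theorems.FrustratedLawDichotomySchurCut (effPot w₄₅ ω₄)
open Summit.AtomisticToContinuum.Crystallization.Theorems.FrustratedLawDichotomyAveragingRuleTightFree (TightNearCap BadNearCap)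
open Summit.AtomisticToContinuum.Crystallization.Theorems.FrustratedLawDichotomyExemptAbsorption (ExemptNear)
open Summit.AtomisticToContinuum.Crystallization.Theorems.FrustratedLawDichotomyStrainedPatchHomSplit
open Summit.AtomisticToContinuum.Crystallization.Theorems.FrustratedLawDichotomyStrainedPatchHomCoords (coord_mem_cube_of_norm_le abs_entry_sub_le_of_near_one)
open Summit.AtomisticToContinuum.Crystallization.Theorems.FrustratedLawDichotomyStrainedPatchHomCertTree (CertTree treeOK treeOK_sound)
open Summit.AtomisticToContinuum.Crystallization.Theorems.FrustratedLawDichotomyStrainedPatchHomEntryGram (rootC rootW)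
open Summit.AtomisticToContinuum.Crystallization.Theorems.FrustratedLawDichotomyStrainedPatchHomEntryGramHcp (rootCH rootWH)
open Summit.AtomisticToContinuum.Crystallization.Theorems.FrustratedLawDichotomyStrainedPatchHomEntryFlipHcp (HcpDich)
open Summit.AtomisticToContinuum.Crystallization.Theorems.FrustratedLawDichotomyStrainedPatchHomEntryLeafHT (hcpCoord HcpLeafGoal)
open Summit.AtomisticToContinuum.Crystallization.Theorems.FrustratedLawDichotomyStrainedPatchHomEntrySemanticQuot
open Literature.Barriers.AtomisticToContinuum.FlatleyTheil2015 (fccVec)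

/-! ## §1. The narrow fcc root box `(rootC, rootWr h)` -/

/-- fcc root HALF-WIDTH `h` on all nine entries (record `rootW` is `h = SC/4 = 2⁴⁶`; the (I3) radius `1/8` is `h = 2⁴⁵`). [this file, hand-1 g45] -/
def rootWr (h : ℤ) : Fin 3 × Fin 3 → ℤ := fun _ => h

/-- ★ Every `U` with `‖U − 1‖ ≤ ρ_U` has its entries in `(rootC, rootWr h)` once `ρ_U·SC ≤ h`. [folklore] -/
theorem mem_rootWr_of_near {ρU : ℝ} {h : ℤ} (hh : ρU * SC ≤ h) {U : E3 →L[ℝ] E3} (hU : ‖U - 1‖ ≤ ρU) (ab : Fin 3 × Fin 3) :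
    |(U (EuclideanSpace.single ab.2 (1 : ℝ))) ab.1 - (rootC ab : ℝ) / SC| ≤ (rootWr h ab : ℝ) / SC := by
  have hS : (0 : ℝ) < SC := SC_pos
  have e1 : (rootC ab : ℝ) / SC = if ab.1 = ab.2 then (1 : ℝ) else 0 := by
    simp only [rootC]
    split_ifs
    · push_cast; exact div_self SC_ne
    · simp
  have hρ : ρU ≤ (rootWr h ab : ℝ) / SC := by
    rw [le_div_iff₀ hS]; exact hh
  rw [e1]
  exact (abs_entry_sub_le_of_near_one hU ab.1 ab.2).trans hρ

/-- ★★ **THE NARROW fcc HALF FROM ONE TREE VERDICT on `(rootC, rootWr h)`** (any leaf verdict sound in the record `hver` shape of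
`…EntryGram.fccHalf_of_entryTree`): the fcc hypothesis of `homFloorW_of_prunedBoxSums_selfAdjoint` at radius `ρ_U ≤ 1/4`, `ρ_U·SC ≤ h`, for every `m` with
`2 (m + e_W) SC ≤ μ`. [folklore] -/
theorem fccHalfW_of_entryTree {ρU m : ℝ} {μ h : ℤ} (hρU : ρU ≤ 1 / 4) (hh : ρU * SC ≤ h) (hμ : 2 * (m + (-(7175 / 10000) + 3 / 400)) * SC ≤ μ)
    (verdict : (Fin 3 × Fin 3 → ℤ) → (Fin 3 × Fin 3 → ℤ) → Bool)
    (hver : ∀ c w, verdict c w = true → ∀ U : E3 →L[ℝ] E3, (∀ v v' : E3, ⟪U v, v'⟫ = ⟪v, U v'⟫) → ‖U - 1‖ ≤ 1 / 4 →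
      (∀ ab : Fin 3 × Fin 3, |(U (EuclideanSpace.single ab.2 (1 : ℝ))) ab.1 - (c ab : ℝ) / SC| ≤ (w ab : ℝ) / SC) →
      (∀ (M : ℕ) (z : Fin M → E3) (c : Fin M), Function.Injective z →
          Set.range z = {x : E3 | dist x (z c) ≤ 133 / 10 ∧ ∃ a : Fin 3 → ℤ, x = z c + latPt U fccVec a} →
          TightNearCap (9 / 5) (3 / 2) z c ∨ ExemptNear (9 / 5) ExRec z c ∨ BadNearCap (9 / 5) (3 / 2) z c) ∨
        (μ : ℝ) / SC ≤ ∑ b ∈ (Fintype.piFinset fun _ : Fin 3 => Finset.Icc (-7 : ℤ) 7).filter (fun b => b ≠ 0),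
          effPot w₄₅ ω₄ (3 / 400) ‖latPt U fccVec b‖)
    {t : CertTree (Fin 3 × Fin 3)} (ht : treeOK verdict t rootC (rootWr h) = true) :
    ∀ U : E3 →L[ℝ] E3, (∀ v w : E3, inner ℝ (U v) w = inner ℝ v (U w)) → (∀ w : E3, 0 ≤ inner ℝ w (U w)) → ‖U - 1‖ ≤ ρU →
      (∀ (M : ℕ) (z : Fin M → E3) (c : Fin M), Function.Injective z →
          Set.range z = {x : E3 | dist x (z c) ≤ 133 / 10 ∧ ∃ a : Fin 3 → ℤ, x = z c + latPt U fccVec a} →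
          TightNearCap (9 / 5) (3 / 2) z c ∨ ExemptNear (9 / 5) ExRec z c ∨ BadNearCap (9 / 5) (3 / 2) z c) ∨
      m ≤ (∑ b ∈ (Fintype.piFinset fun _ : Fin 3 => Finset.Icc (-7 : ℤ) 7).filter (fun b => b ≠ 0),
        effPot w₄₅ ω₄ (3 / 400) ‖latPt U fccVec b‖) / 2 - (-(7175 / 10000) + 3 / 400) := by
  intro U hsa _hpos hU
  have hS := SC_pos
  have hU4 : ‖U - 1‖ ≤ 1 / 4 := hU.trans hρU
  have key := treeOK_sound SC_pos
    (P := fun x : Fin 3 × Fin 3 → ℝ => ∀ U : E3 →L[ℝ] E3, (∀ v v' : E3, ⟪U v, v'⟫ = ⟪v, U v'⟫) → ‖U - 1‖ ≤ 1 / 4 →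
      (∀ ab : Fin 3 × Fin 3, (U (EuclideanSpace.single ab.2 (1 : ℝ))) ab.1 = x ab) →
      (∀ (M : ℕ) (z : Fin M → E3) (c : Fin M), Function.Injective z →
          Set.range z = {x : E3 | dist x (z c) ≤ 133 / 10 ∧ ∃ a : Fin 3 → ℤ, x = z c + latPt U fccVec a} →
          TightNearCap (9 / 5) (3 / 2) z c ∨ ExemptNear (9 / 5) ExRec z c ∨ BadNearCap (9 / 5) (3 / 2) z c) ∨
        (μ : ℝ) / SC ≤ ∑ b ∈ (Fintype.piFinset fun _ : Fin 3 => Finset.Icc (-7 : ℤ) 7).filter (fun b => b ≠ 0),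
          effPot w₄₅ ω₄ (3 / 400) ‖latPt U fccVec b‖)
    verdict (fun c w hv x hx V hVsa hV1 hVx => hver c w hv V hVsa hV1 fun ab => by rw [hVx ab]; exact hx ab) t rootC (rootWr h) ht
    (fun ab => (U (EuclideanSpace.single ab.2 (1 : ℝ))) ab.1) (mem_rootWr_of_near hh hU) U hsa hU4 (fun _ => rfl)
  refine key.imp id fun hfloor => ?_
  have h2 : 2 * (m + (-(7175 / 10000) + 3 / 400)) ≤ (μ : ℝ) / SC := by
    rw [le_div_iff₀ hS]; exact hμ
  linarith

/-! ## §2. The narrow quarter root box `(rootCHQr k, rootWHQr h k hξ)` -/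

/-- hcp quarter root CENTRE with wall parameter `k`: `rootCH` with `u₀₁`-centre `k` and `u₁₂`-centre `−k` (record `rootCHQ` is `k = 2⁴⁵ = SC/8`).
[this file, hand-1 g45] -/
def rootCHQr (k : ℤ) : (Fin 3 × Fin 3) ⊕ Fin 3 → ℤ :=
  Function.update (Function.update rootCH (Sum.inl (0, 1)) k) (Sum.inl (1, 2)) (-k)

/-- hcp quarter root HALF-WIDTH: `k` on the two wall entries, `h` on the other entries, `wξ` on the three shuffles (record `rootWHQ` is
`(h, k, wξ) = (2⁴⁶, 2⁴⁵, 2⁴⁶)`). [this file, hand-1 g45] -/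
def rootWHQr (h k wξ : ℤ) : (Fin 3 × Fin 3) ⊕ Fin 3 → ℤ :=
  Sum.elim (fun ab => if ab = (0, 1) ∨ ab = (1, 2) then k else h) (fun _ => wξ)

/-- Values on the wall entry `(1,2)`. [formal bookkeeping] -/
theorem rootCHQr_wall12 (k : ℤ) : rootCHQr k (Sum.inl (1, 2)) = -k := by simp [rootCHQr]
/-- Values on the wall entry `(1,2)`. [formal bookkeeping] -/
theorem rootWHQr_wall12 (h k wξ : ℤ) : rootWHQr h k wξ (Sum.inl (1, 2)) = k := by simp [rootWHQr]
/-- Values on the wall entry `(0,1)`. [formal bookkeeping] -/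
theorem rootCHQr_wall01 (k : ℤ) : rootCHQr k (Sum.inl (0, 1)) = k := by simp [rootCHQr]
/-- Values on the wall entry `(0,1)`. [formal bookkeeping] -/
theorem rootWHQr_wall01 (h k wξ : ℤ) : rootWHQr h k wξ (Sum.inl (0, 1)) = k := by simp [rootWHQr]
/-- Off the walls the centre is the record `rootCH`. [formal bookkeeping] -/
theorem rootCHQr_of_ne {k : ℤ} {i : (Fin 3 × Fin 3) ⊕ Fin 3} (h1 : i ≠ Sum.inl (1, 2)) (h0 : i ≠ Sum.inl (0, 1)) : rootCHQr k i = rootCH i := by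
  simp [rootCHQr, h1, h0]
/-- Off the walls the half-width is `h` on entries. [formal bookkeeping] -/
theorem rootWHQr_entry_of_ne {h k wξ : ℤ} {ab : Fin 3 × Fin 3} (h1 : (Sum.inl ab : (Fin 3 × Fin 3) ⊕ Fin 3) ≠ Sum.inl (1, 2))
    (h0 : (Sum.inl ab : (Fin 3 × Fin 3) ⊕ Fin 3) ≠ Sum.inl (0, 1)) : rootWHQr h k wξ (Sum.inl ab) = h := by
  have h1' : ab ≠ (1, 2) := fun e => h1 (by rw [e])
  have h0' : ab ≠ (0, 1) := fun e => h0 (by rw [e])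
  simp [rootWHQr, h1', h0']
/-- On the shuffles the half-width is `hξ`. [formal bookkeeping] -/
theorem rootWHQr_shuffle (h k wξ : ℤ) (i : Fin 3) : rootWHQr h k wξ (Sum.inr i) = wξ := by simp [rootWHQr]

/-- ★ **CONTAINMENT**: every `(U, ξ)` with `‖U − 1‖ ≤ ρ_U`, `‖ξ‖ ≤ ρ_ξ` and the walls `0 ≤ u₀₁`, `u₁₂ ≤ 0` lies in `(rootCHQr k, rootWHQr h k hξ)` once
`ρ_U·SC ≤ h`, `ρ_U·SC ≤ 2k`, `ρ_ξ·SC ≤ hξ` (record `mem_rootQ`: `ρ = 1/4`, `h = hξ = SC/4`, `k = SC/8`). [folklore] -/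
theorem mem_rootQr {ρU ρξ : ℝ} {h k wξ : ℤ} (hh : ρU * SC ≤ h) (hk : ρU * SC ≤ 2 * k) (hw : ρξ * SC ≤ wξ)
    {U : E3 →L[ℝ] E3} {ξ : E3} (hU : ‖U - 1‖ ≤ ρU) (hξ : ‖ξ‖ ≤ ρξ) (h01 : 0 ≤ (U (EuclideanSpace.single 1 (1 : ℝ))) 0)
    (h12 : (U (EuclideanSpace.single 2 (1 : ℝ))) 1 ≤ 0) : ∀ i, |hcpCoord U ξ i - (rootCHQr k i : ℝ) / SC| ≤ (rootWHQr h k wξ i : ℝ) / SC := by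
  have hS : (0 : ℝ) < SC := SC_pos
  have hent : ∀ ab : Fin 3 × Fin 3, |(U (EuclideanSpace.single ab.2 (1 : ℝ))) ab.1 - (if ab.1 = ab.2 then (1 : ℝ) else 0)| ≤ ρU :=
    fun ab => abs_entry_sub_le_of_near_one hU ab.1 ab.2
  have hρh : ρU ≤ (h : ℝ) / SC := by rw [le_div_iff₀ hS]; exact hh
  have hρk : ρU ≤ 2 * ((k : ℝ) / SC) := by rw [mul_div_assoc', le_div_iff₀ hS]; exact_mod_cast hk
  have hρx : ρξ ≤ (wξ : ℝ) / SC := by rw [le_div_iff₀ hS]; exact hw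
  intro i
  by_cases hi12 : i = Sum.inl (1, 2)
  · subst hi12
    rw [rootCHQr_wall12, rootWHQr_wall12]
    have e := hent (1, 2)
    simp only [show ((1 : Fin 3) = 2 ↔ False) by decide, if_false, sub_zero] at e
    simp only [hcpCoord, Sum.elim_inl]
    have hq : (((-k : ℤ) : ℝ)) / SC = -(((k : ℤ) : ℝ) / SC) := by rw [Int.cast_neg, neg_div]
    rw [hq, abs_le]
    rw [abs_le] at e
    constructor <;> linarith [e.1, e.2, h12, hρk]
  by_cases hi01 : i = Sum.inl (0, 1)
  · subst hi01
    rw [rootCHQr_wall01, rootWHQr_wall01]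
    have e := hent (0, 1)
    simp only [show ((0 : Fin 3) = 1 ↔ False) by decide, if_false, sub_zero] at e
    simp only [hcpCoord, Sum.elim_inl]
    rw [abs_le] at e ⊢
    constructor <;> linarith [e.1, e.2, h01, hρk]
  rw [rootCHQr_of_ne hi12 hi01]
  rcases i with ab | j
  · rw [rootWHQr_entry_of_ne hi12 hi01]
    simp only [hcpCoord, Sum.elim_inl, rootCH, Sum.elim_inl, rootC]
    have e := hent ab
    have e1 : ((if ab.1 = ab.2 then (SC : ℤ) else 0 : ℤ) : ℝ) / SC = if ab.1 = ab.2 then (1 : ℝ) else 0 := by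
      split_ifs
      · push_cast; exact div_self SC_ne
      · simp
    rw [e1]
    exact e.trans hρh
  · rw [rootWHQr_shuffle]
    simp only [hcpCoord, Sum.elim_inr, rootCH, Sum.elim_inr]
    push_cast
    rw [zero_div, sub_zero]
    have hc := coord_mem_cube_of_norm_le hξ j
    exact (abs_le.2 ⟨by linarith [hc.1], hc.2⟩).trans hρx

/-! ## §3. `(H_W)` from ONE fcc tree fact and ONE `semOKHQ` fact on the narrow boxes -/

/-- ★★ **THE NARROW hcp HALF FROM ONE `semOKHQ` FACT ON THE NARROW QUARTER ROOT BOX.** [folklore chaining] -/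
theorem hcpDichW_of_semOKHQ_rootQr {ρU ρξ m : ℝ} {μ h k wξ : ℤ} (hρU : ρU ≤ 1 / 4) (hρξ : ρξ ≤ 1 / 4) (hh : ρU * SC ≤ h) (hk : ρU * SC ≤ 2 * k)
    (hw : ρξ * SC ≤ wξ) (hμ : 2 * (m + (-(7175 / 10000) + 3 / 400)) * SC ≤ μ) (hH : semOKHQ μ (rootCHQr k) (rootWHQr h k wξ) = true) :
    ∀ (U : E3 →L[ℝ] E3) (ξ : E3), (∀ v w : E3, inner ℝ (U v) w = inner ℝ v (U w)) → (∀ w : E3, 0 ≤ inner ℝ w (U w)) →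
      ‖U - 1‖ ≤ ρU → ‖ξ‖ ≤ ρξ → HcpDich m U ξ :=
  hcpDichW_of_semOKHQ_box hρU hρξ (fun _ _ hU hξ' h01 h12 => mem_rootQr hh hk hw hU hξ' h01 h12) hμ hH

/-- ★★★ **`(H_W) HomFloorW ρ_U ρ_ξ m` FROM ONE fcc TREE FACT on `(rootC, rootWr h)` AND ONE `semOKHQ` FACT on `(rootCHQr k, rootWHQr h k hξ)`** — the narrow
twin of `…EntrySemanticQuot.homFloor_of_entryTree6RBKP4_semOKHQ` with a generic fcc verdict (pass the record verdict and its `hver` soundness, e.g.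
`entryLeafOK6RBKP4` with `entryLeafOK6RBKP4_sound`-shaped lemma). [folklore chaining] -/
theorem homFloorW_of_entryTree_semOKHQ_rootQr {ρU ρξ m : ℝ} {μ h k wξ : ℤ} (hρU : ρU ≤ 1 / 4) (hρξ : ρξ ≤ 1 / 4) (hh : ρU * SC ≤ h)
    (hk : ρU * SC ≤ 2 * k) (hw : ρξ * SC ≤ wξ) (hμ : 2 * (m + (-(7175 / 10000) + 3 / 400)) * SC ≤ μ)
    (verdict : (Fin 3 × Fin 3 → ℤ) → (Fin 3 × Fin 3 → ℤ) → Bool)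
    (hver : ∀ c w, verdict c w = true → ∀ U : E3 →L[ℝ] E3, (∀ v v' : E3, ⟪U v, v'⟫ = ⟪v, U v'⟫) → ‖U - 1‖ ≤ 1 / 4 →
      (∀ ab : Fin 3 × Fin 3, |(U (EuclideanSpace.single ab.2 (1 : ℝ))) ab.1 - (c ab : ℝ) / SC| ≤ (w ab : ℝ) / SC) →
      (∀ (M : ℕ) (z : Fin M → E3) (c : Fin M), Function.Injective z →
          Set.range z = {x : E3 | dist x (z c) ≤ 133 / 10 ∧ ∃ a : Fin 3 → ℤ, x = z c + latPt U fccVec a} →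
          TightNearCap (9 / 5) (3 / 2) z c ∨ ExemptNear (9 / 5) ExRec z c ∨ BadNearCap (9 / 5) (3 / 2) z c) ∨
        (μ : ℝ) / SC ≤ ∑ b ∈ (Fintype.piFinset fun _ : Fin 3 => Finset.Icc (-7 : ℤ) 7).filter (fun b => b ≠ 0),
          effPot w₄₅ ω₄ (3 / 400) ‖latPt U fccVec b‖)
    {t : CertTree (Fin 3 × Fin 3)} (ht : treeOK verdict t rootC (rootWr h) = true) (hH : semOKHQ μ (rootCHQr k) (rootWHQr h k wξ) = true) :
    HomFloorW ρU ρξ m :=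
  homFloorW_of_fccPruned_of_hcpDichW hρU hρξ (fccHalfW_of_entryTree hρU hh hμ verdict hver ht) (hcpDichW_of_semOKHQ_rootQr hρU hρξ hh hk hw hμ hH)

/-- `2⁴⁵ = SC/8` and `2⁴⁴ = SC/16`: the (I3) side conditions `(1/8)·SC ≤ 2⁴⁵`, `(1/8)·SC ≤ 2·2⁴⁴`, `(1/16)·SC ≤ 2⁴⁴`. [arithmetic] -/
theorem i3_side_conditions : (1 / 8 : ℝ) * SC ≤ (35184372088832 : ℤ) ∧ (1 / 8 : ℝ) * SC ≤ 2 * ((17592186044416 : ℤ) : ℝ) ∧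
    (1 / 16 : ℝ) * SC ≤ (17592186044416 : ℤ) := by
  refine ⟨?_, ?_, ?_⟩ <;> norm_num [SC]

/-- ★ The (I3) corollary: `HomFloorW (1/8) (1/16) m` from ONE fcc tree fact on `(rootC, rootWr 2⁴⁵)` and ONE `semOKHQ` fact on
`(rootCHQr 2⁴⁴, rootWHQr 2⁴⁵ 2⁴⁴ 2⁴⁴)`. [folklore chaining] -/
theorem homFloorW_eighth_sixteenth_of_entryTree_semOKHQ {m : ℝ} {μ : ℤ} (hμ : 2 * (m + (-(7175 / 10000) + 3 / 400)) * SC ≤ μ)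
    (verdict : (Fin 3 × Fin 3 → ℤ) → (Fin 3 × Fin 3 → ℤ) → Bool)
    (hver : ∀ c w, verdict c w = true → ∀ U : E3 →L[ℝ] E3, (∀ v v' : E3, ⟪U v, v'⟫ = ⟪v, U v'⟫) → ‖U - 1‖ ≤ 1 / 4 →
      (∀ ab : Fin 3 × Fin 3, |(U (EuclideanSpace.single ab.2 (1 : ℝ))) ab.1 - (c ab : ℝ) / SC| ≤ (w ab : ℝ) / SC) →
      (∀ (M : ℕ) (z : Fin M → E3) (c : Fin M), Function.Injective z →
          Set.range z = {x : E3 | dist x (z c) ≤ 133 / 10 ∧ ∃ a : Fin 3 → ℤ, x = z c + latPt U fccVec a} →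
          TightNearCap (9 / 5) (3 / 2) z c ∨ ExemptNear (9 / 5) ExRec z c ∨ BadNearCap (9 / 5) (3 / 2) z c) ∨
        (μ : ℝ) / SC ≤ ∑ b ∈ (Fintype.piFinset fun _ : Fin 3 => Finset.Icc (-7 : ℤ) 7).filter (fun b => b ≠ 0),
          effPot w₄₅ ω₄ (3 / 400) ‖latPt U fccVec b‖)
    {t : CertTree (Fin 3 × Fin 3)} (ht : treeOK verdict t rootC (rootWr 35184372088832) = true)
    (hH : semOKHQ μ (rootCHQr 17592186044416) (rootWHQr 35184372088832 17592186044416 17592186044416) = true) :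
    HomFloorW (1 / 8) (1 / 16) m :=
  homFloorW_of_entryTree_semOKHQ_rootQr (by norm_num) (by norm_num) i3_side_conditions.1 i3_side_conditions.2.1 i3_side_conditions.2.2 hμ
    verdict hver ht hH

end Summit.AtomisticToContinuum.Crystallization.Theorems.FrustratedLawDichotomyStrainedPatchHomSplitNarrow

end
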